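import Summits.CriticalPhenomena.SAWScalingLimit.Theorems.SAWLeftRightFKGLeftRightFKGTP2Defs
import Summits.CriticalPhenomena.SAWScalingLimit.Theorems.SAWLeftRightFKGLeftRightFKGStubEndpointMonotoneAux2
import Summits.CriticalPhenomena.SAWScalingLimit.Theorems.SAWLeftRightFKGLeftRightFKGStubLensDichotomy
import HarnessLib

/-!
# Stub `stub_cornerAssembly` of line `corner-localisation` (lead c1 reshape v5), helper file 2: classes and order

Crux `LeftRightFKG` (stmt-CriticalPhenomena-11232). Combinatorics of a prefix/suffix class `cls k π m σ` of chords
`SAW.DomainSAW Ω δ a b` with at least two members, and the three ORDER inputs of the assembly: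

* `le_length_of_two`: every chord of such a class has length `≥ k + m + 1` (prefix and suffix do not overlap);
* `mem_fixedSet_iff`, `next_not_mem_fixedSet`, `prev_not_mem_fixedSet`, `adj_next`, `adj_prev`: the fixed vertices
  are the chord's own prefix/suffix vertices; the next/previous free steps of a chord of length `≥ k + m + 2` are
  free neighbours of the two marked points `π k`, `σ m`;
* `length_eq_of_next_mem_fixedSet`, `direct_unique`: the only chord whose next step is fixed is the DIRECT chord
  (length `k + m + 1`, `π k ∼ σ m`), and it is unique;
* `direct_comparable`: the direct chord is `≼`-comparable with every chord of the class (landed lens dichotomy,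
  vacuously disjoint free middles);
* `freeMeet_of_inversion`, `freeMeet_of_inversionR`, `freeMeet_of_crossed`: the free middles of two chords MEET
  when an up-event separates them against the step ranking (inversion), or when their next-step and previous-step
  ranks are oppositely ordered (crossed pair) — relative up-closure + `StepMonotone` rankings + lens dichotomy.
-/

noncomputable section

open Finset SimpleGraph
open Literature.Probability.LatticeModels Literature.Probability.RandomPlanarGeometry
open scoped Classical

namespace Summit.CriticalPhenomena.SAWScalingLimit.Theorems.LeftRightFKG.CornerLoc

namespace CornerAssembly

section General

variable {Ω : Set ℂ} {δ : ℝ} {a b : Site 2} {k : ℕ} {π : ℕ → Site 2} {m : ℕ} {σ : ℕ → Site 2}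

/-- The length of a chord is the length of its walk. [folklore] -/
theorem length_eq (γ : SAW.DomainSAW Ω δ a b) : γ.length = γ.walk.length := rfl

/-- Positions of a chord are injective up to its length. [folklore] -/
theorem getVert_inj (γ : SAW.DomainSAW Ω δ a b) {i j : ℕ} (hi : i ≤ γ.length) (hj : j ≤ γ.length)
    (h : γ.walk.getVert i = γ.walk.getVert j) : i = j :=
  γ.isPath.getVert_injOn hi hj h

/-- `Freemeet` is symmetric. [folklore] -/
theorem FreeMeet.symm {γ₁ γ₂ : SAW.DomainSAW Ω δ a b} (h : FreeMeet k m γ₁ γ₂) : FreeMeet k m γ₂ γ₁ := by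
  obtain ⟨i, j, hi, him, hj, hjm, h⟩ := h
  exact ⟨j, i, hj, hjm, hi, him, h.symm⟩

/-- Not meeting, unfolded as the disjointness hypothesis of the lens dichotomy. [folklore] -/
theorem not_freeMeet_iff {γ₁ γ₂ : SAW.DomainSAW Ω δ a b} : ¬ FreeMeet k m γ₁ γ₂ ↔
    ∀ i j : ℕ, k < i → i + m < γ₁.length → k < j → j + m < γ₂.length →
      γ₁.walk.getVert i ≠ γ₂.walk.getVert j := by
  simp only [FreeMeet, not_exists, not_and]

/-- LONG CHORDS: in a class with two distinct members every member has length `≥ k + m + 1` (otherwise its prefix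
and suffix windows cover all positions and pin down every other member). [folklore] -/
theorem le_length_of_two {γ₁ γ₂ : SAW.DomainSAW Ω δ a b} (h₁ : γ₁ ∈ cls k π m σ) (h₂ : γ₂ ∈ cls k π m σ)
    (hne : γ₁ ≠ γ₂) {γ : SAW.DomainSAW Ω δ a b} (hγ : γ ∈ cls k π m σ) : k + m + 1 ≤ γ.length := by
  -- another member `γ'` of the class
  obtain ⟨γ', hγ', hne'⟩ : ∃ γ', γ' ∈ cls k π m σ ∧ γ' ≠ γ := by
    by_cases h : γ₁ = γ
    · exact ⟨γ₂, h₂, fun e => hne (h.trans e.symm)⟩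
    · exact ⟨γ₁, h₁, h⟩
  obtain ⟨hk, hm⟩ := EndpointMonotone.lt_length_of_ne hγ hγ' hne'.symm
  obtain ⟨hk', hm'⟩ := EndpointMonotone.lt_length_of_ne hγ' hγ hne'
  by_contra hlt
  push Not at hlt
  set L := γ.length with hL
  set L' := γ'.length with hL'
  obtain ⟨hγa, hγr⟩ : AgreeTo k π γ ∧ AgreeToR m σ γ := hγ
  obtain ⟨hγ'a, hγ'r⟩ : AgreeTo k π γ' ∧ AgreeToR m σ γ' := hγ'
  -- `γ'` passes through `σ m` at position `L - m ≤ k` and at position `L' - m`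
  have e1 : γ'.walk.getVert (L - m) = σ m := by
    rw [hγ'a (L - m) (by omega), ← hγa (L - m) (by omega)]
    have := hγr m le_rfl
    rwa [Walk.getVert_reverse] at this
  have e2 : γ'.walk.getVert (L' - m) = σ m := by
    have := hγ'r m le_rfl
    rwa [Walk.getVert_reverse] at this
  have hLL' : L - m = L' - m :=
    getVert_inj γ' (by change L - m ≤ L'; omega) (by change L' - m ≤ L'; omega) (e1.trans e2.symm)
  have hlen : γ.walk.length = γ'.walk.length := by change L = L'; omega
  refine hne' (EndpointMonotone.ext_walk (Walk.ext_getVert_le_length hlen fun i hi => ?_)).symm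
  by_cases hik : i ≤ k
  · rw [hγ'a i hik, hγa i hik]
  · -- `i = L - j` with `j ≤ m`
    have hi' : i ≤ L := hi
    obtain ⟨j, hj, rfl⟩ : ∃ j, j ≤ m ∧ i = L - j := ⟨L - i, by omega, by omega⟩
    have eγ := hγr j hj
    have eγ' := hγ'r j hj
    rw [Walk.getVert_reverse] at eγ eγ'
    change γ.walk.getVert (L - j) = σ j at eγ
    change γ'.walk.getVert (L' - j) = σ j at eγ'
    rw [show L' = L by omega] at eγ'
    rw [eγ, eγ']

/-- The fixed vertices of the class are the prefix and suffix vertices of any member. [folklore] -/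
theorem mem_fixedSet_iff {γ : SAW.DomainSAW Ω δ a b} (hγ : γ ∈ cls k π m σ) {v : Site 2} :
    v ∈ fixedSet k π m σ ↔
      (∃ i, i ≤ k ∧ γ.walk.getVert i = v) ∨ ∃ j, j ≤ m ∧ γ.walk.getVert (γ.length - j) = v := by
  obtain ⟨hγa, hγr⟩ : AgreeTo k π γ ∧ AgreeToR m σ γ := hγ
  simp only [fixedSet, Set.mem_setOf_eq]
  constructor
  · rintro (⟨i, hi, rfl⟩ | ⟨j, hj, rfl⟩)
    · exact Or.inl ⟨i, hi, hγa i hi⟩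
    · refine Or.inr ⟨j, hj, ?_⟩
      have := hγr j hj
      rwa [Walk.getVert_reverse] at this
  · rintro (⟨i, hi, rfl⟩ | ⟨j, hj, rfl⟩)
    · exact Or.inl ⟨i, hi, (hγa i hi).symm⟩
    · refine Or.inr ⟨j, hj, ?_⟩
      have := hγr j hj
      rw [Walk.getVert_reverse] at this
      exact this.symm

/-- The next free step of a chord of length `≥ k + m + 2` is not fixed. [folklore] -/
theorem next_not_mem_fixedSet {γ : SAW.DomainSAW Ω δ a b} (hγ : γ ∈ cls k π m σ) (hL : k + m + 2 ≤ γ.length) :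
    γ.walk.getVert (k + 1) ∉ fixedSet k π m σ := by
  rw [mem_fixedSet_iff hγ]
  rintro (⟨i, hi, e⟩ | ⟨j, hj, e⟩)
  · have := getVert_inj γ (by omega) (by omega) e; omega
  · have := getVert_inj γ (by omega) (by omega) e; omega

/-- The previous free step of a chord of length `≥ k + m + 2` is not fixed. [folklore] -/
theorem prev_not_mem_fixedSet {γ : SAW.DomainSAW Ω δ a b} (hγ : γ ∈ cls k π m σ) (hL : k + m + 2 ≤ γ.length) :
    γ.walk.reverse.getVert (m + 1) ∉ fixedSet k π m σ := by
  rw [Walk.getVert_reverse, mem_fixedSet_iff hγ, ← length_eq]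
  rintro (⟨i, hi, e⟩ | ⟨j, hj, e⟩)
  · have := getVert_inj γ (by omega) (by omega) e; omega
  · have := getVert_inj γ (by omega) (by omega) e; omega

/-- The next free step is a domain neighbour of the marked point `π k`. [folklore] -/
theorem adj_next {γ : SAW.DomainSAW Ω δ a b} (hγ : γ ∈ cls k π m σ) (hk : k < γ.length) :
    (discreteDomainGraph Ω δ).Adj (π k) (γ.walk.getVert (k + 1)) := by
  obtain ⟨hγa, -⟩ : AgreeTo k π γ ∧ AgreeToR m σ γ := hγ
  rw [← hγa k le_rfl]
  exact γ.walk.adj_getVert_succ hk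

/-- The previous free step is a domain neighbour of the marked point `σ m`. [folklore] -/
theorem adj_prev {γ : SAW.DomainSAW Ω δ a b} (hγ : γ ∈ cls k π m σ) (hm : m < γ.length) :
    (discreteDomainGraph Ω δ).Adj (γ.walk.reverse.getVert (m + 1)) (σ m) := by
  obtain ⟨-, hγr⟩ : AgreeTo k π γ ∧ AgreeToR m σ γ := hγ
  rw [← hγr m le_rfl]
  exact (γ.walk.reverse.adj_getVert_succ (by rw [Walk.length_reverse]; exact hm)).symm

/-- A chord of length `≥ k + m + 1` whose next step is fixed is the DIRECT chord: it has length exactly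
`k + m + 1`. [folklore] -/
theorem length_eq_of_next_mem_fixedSet {γ : SAW.DomainSAW Ω δ a b} (hγ : γ ∈ cls k π m σ)
    (hL : k + m + 1 ≤ γ.length) (hfix : γ.walk.getVert (k + 1) ∈ fixedSet k π m σ) : γ.length = k + m + 1 := by
  by_contra h
  exact next_not_mem_fixedSet hγ (by omega) hfix

/-- The next step of the direct chord is the marked point `σ m`. [folklore] -/
theorem next_eq_of_length_eq {γ : SAW.DomainSAW Ω δ a b} (hγ : γ ∈ cls k π m σ) (hL : γ.length = k + m + 1) :
    γ.walk.getVert (k + 1) = σ m := by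
  obtain ⟨-, hγr⟩ : AgreeTo k π γ ∧ AgreeToR m σ γ := hγ
  have := hγr m le_rfl
  rw [Walk.getVert_reverse, ← length_eq, hL, show k + m + 1 - m = k + 1 by omega] at this
  exact this

/-- The direct chord is unique. [folklore] -/
theorem direct_unique {γ γ' : SAW.DomainSAW Ω δ a b} (hγ : γ ∈ cls k π m σ) (hγ' : γ' ∈ cls k π m σ)
    (hL : γ.length = k + m + 1) (hL' : γ'.length = k + m + 1) : γ = γ' := by
  obtain ⟨hγa, hγr⟩ : AgreeTo k π γ ∧ AgreeToR m σ γ := hγ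
  obtain ⟨hγ'a, hγ'r⟩ : AgreeTo k π γ' ∧ AgreeToR m σ γ' := hγ'
  have hlen : γ.walk.length = γ'.walk.length := by rw [← length_eq, ← length_eq, hL, hL']
  refine EndpointMonotone.ext_walk (Walk.ext_getVert_le_length hlen fun i hi => ?_)
  by_cases hik : i ≤ k
  · rw [hγa i hik, hγ'a i hik]
  · obtain ⟨j, hj, rfl⟩ : ∃ j, j ≤ m ∧ i = k + m + 1 - j := ⟨k + m + 1 - i, by omega, by
      rw [← length_eq, hL] at hi; omega⟩
    have e := hγr j hj
    have e' := hγ'r j hj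
    rw [Walk.getVert_reverse, ← length_eq, hL] at e
    rw [Walk.getVert_reverse, ← length_eq, hL'] at e'
    rw [e, e']

end General

/-! ## Order inputs (crux instances) -/

section Order

variable {δ : ℝ} {c a b a' b' : Site 2} {C : (zdGraph 2).Walk c c} {k : ℕ} {π : ℕ → Site 2} {m : ℕ}
  {σ : ℕ → Site 2}

/-- THE DIRECT CHORD IS COMPARABLE WITH EVERY CHORD of its class (lens dichotomy with vacuously disjoint free
middles). [folklore] -/
theorem direct_comparable (hI : IsInst δ a b a' b' C) {γ₀ γ : SAW.DomainSAW (dom C δ) δ a b}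
    (h₀ : γ₀ ∈ cls k π m σ) (hγ : γ ∈ cls k π m σ) (hne : γ₀ ≠ γ) (hL : γ₀.length ≤ k + m + 1) :
    lr γ₀ γ ∨ lr γ γ₀ :=
  stub_lensDichotomy δ c a b a' b' C hI k π m σ γ₀ γ hne h₀ hγ fun i _ hi him _ _ _ => by omega

/-- INVERSION AT THE NEAR END FORCES MEETING: if a relative up-set `E` of the class contains `γ₁` but not `γ₂`
while the next-step rank of `γ₁` is SMALLER than that of `γ₂` (for a ranking monotone in `≼`), then the free
middles of `γ₁` and `γ₂` meet. [folklore] -/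
theorem freeMeet_of_inversion (hI : IsInst δ a b a' b' C) {r : Site 2 → ℕ}
    (hr : ∀ γ₁ γ₂ : SAW.DomainSAW (dom C δ) δ a b, AgreeTo k π γ₁ → AgreeTo k π γ₂ → lr γ₁ γ₂ →
      r (γ₁.walk.getVert (k + 1)) ≤ r (γ₂.walk.getVert (k + 1)))
    {E : Set (SAW.DomainSAW (dom C δ) δ a b)} (hE : IsUpOn (cls k π m σ) E)
    {γ₁ γ₂ : SAW.DomainSAW (dom C δ) δ a b} (h₁ : γ₁ ∈ cls k π m σ) (h₂ : γ₂ ∈ cls k π m σ)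
    (hE₁ : γ₁ ∈ E) (hE₂ : γ₂ ∉ E) (hlt : r (γ₁.walk.getVert (k + 1)) < r (γ₂.walk.getVert (k + 1))) :
    FreeMeet k m γ₁ γ₂ := by
  by_contra hfm
  have hne : γ₁ ≠ γ₂ := fun e => hE₂ (e ▸ hE₁)
  rcases stub_lensDichotomy δ c a b a' b' C hI k π m σ γ₁ γ₂ hne h₁ h₂ (not_freeMeet_iff.1 hfm) with h | h
  · exact hE₂ (hE γ₁ γ₂ h₁ h₂ h hE₁)
  · exact absurd (hr γ₂ γ₁ h₂.1 h₁.1 h) (not_le.2 hlt)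

/-- INVERSION AT THE FAR END FORCES MEETING (mirror statement for previous-step ranks and `AgreeToR`).
[folklore] -/
theorem freeMeet_of_inversionR (hI : IsInst δ a b a' b' C) {r : Site 2 → ℕ}
    (hr : ∀ γ₁ γ₂ : SAW.DomainSAW (dom C δ) δ a b, AgreeToR m σ γ₁ → AgreeToR m σ γ₂ → lr γ₁ γ₂ →
      r (γ₁.walk.reverse.getVert (m + 1)) ≤ r (γ₂.walk.reverse.getVert (m + 1)))
    {F : Set (SAW.DomainSAW (dom C δ) δ a b)} (hF : IsUpOn (cls k π m σ) F)
    {γ₁ γ₂ : SAW.DomainSAW (dom C δ) δ a b} (h₁ : γ₁ ∈ cls k π m σ) (h₂ : γ₂ ∈ cls k π m σ)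
    (hF₁ : γ₁ ∈ F) (hF₂ : γ₂ ∉ F)
    (hlt : r (γ₁.walk.reverse.getVert (m + 1)) < r (γ₂.walk.reverse.getVert (m + 1))) :
    FreeMeet k m γ₁ γ₂ := by
  by_contra hfm
  have hne : γ₁ ≠ γ₂ := fun e => hF₂ (e ▸ hF₁)
  rcases stub_lensDichotomy δ c a b a' b' C hI k π m σ γ₁ γ₂ hne h₁ h₂ (not_freeMeet_iff.1 hfm) with h | h
  · exact hF₂ (hF γ₁ γ₂ h₁ h₂ h hF₁)
  · exact absurd (hr γ₂ γ₁ h₂.2 h₁.2 h) (not_le.2 hlt)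

/-- A CROSSED PAIR MEETS: if the next-step rank of `γ₁` exceeds that of `γ₂` while the previous-step rank of
`γ₁` is below that of `γ₂`, the two chords are `≼`-incomparable, hence (lens dichotomy) their free middles meet.
[folklore] -/
theorem freeMeet_of_crossed (hI : IsInst δ a b a' b' C) {r r' : Site 2 → ℕ}
    (hr : ∀ γ₁ γ₂ : SAW.DomainSAW (dom C δ) δ a b, AgreeTo k π γ₁ → AgreeTo k π γ₂ → lr γ₁ γ₂ →
      r (γ₁.walk.getVert (k + 1)) ≤ r (γ₂.walk.getVert (k + 1)))
    (hr' : ∀ γ₁ γ₂ : SAW.DomainSAW (dom C δ) δ a b, AgreeToR m σ γ₁ → AgreeToR m σ γ₂ → lr γ₁ γ₂ →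
      r' (γ₁.walk.reverse.getVert (m + 1)) ≤ r' (γ₂.walk.reverse.getVert (m + 1)))
    {γ₁ γ₂ : SAW.DomainSAW (dom C δ) δ a b} (h₁ : γ₁ ∈ cls k π m σ) (h₂ : γ₂ ∈ cls k π m σ)
    (hnext : r (γ₂.walk.getVert (k + 1)) < r (γ₁.walk.getVert (k + 1)))
    (hprev : r' (γ₁.walk.reverse.getVert (m + 1)) < r' (γ₂.walk.reverse.getVert (m + 1))) :
    FreeMeet k m γ₁ γ₂ := by
  by_contra hfm
  have hne : γ₁ ≠ γ₂ := by
    rintro rfl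
    exact lt_irrefl _ hnext
  rcases stub_lensDichotomy δ c a b a' b' C hI k π m σ γ₁ γ₂ hne h₁ h₂ (not_freeMeet_iff.1 hfm) with h | h
  · exact absurd (hr γ₁ γ₂ h₁.1 h₂.1 h) (not_le.2 hnext)
  · exact absurd (hr' γ₂ γ₁ h₂.2 h₁.2 h) (not_le.2 hprev)

end Order

end CornerAssembly

/-- REGISTERED SUB-GOAL `stub_cornerAssemblyAux2` of stub `stub_cornerAssembly` (this helper file's pivot, recorded on
the crux item so that the file lands as a `--supports` proof): in a class with two distinct chords every chord has
length `≥ k + m + 1` (`CornerAssembly.le_length_of_two`). [folklore] -/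
theorem stub_cornerAssemblyAux2 : ∀ {Ω : Set ℂ} {δ : ℝ} {a b : Site 2} {k : ℕ} {π : ℕ → Site 2} {m : ℕ}
    {σ : ℕ → Site 2} {γ₁ γ₂ : SAW.DomainSAW Ω δ a b}, γ₁ ∈ cls k π m σ → γ₂ ∈ cls k π m σ → γ₁ ≠ γ₂ →
    ∀ {γ : SAW.DomainSAW Ω δ a b}, γ ∈ cls k π m σ → k + m + 1 ≤ γ.length :=
  fun h₁ h₂ hne _ hγ => CornerAssembly.le_length_of_two h₁ h₂ hne hγ

end Summit.CriticalPhenomena.SAWScalingLimit.Theorems.LeftRightFKG.CornerLoc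

end
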